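import Summits.QuantumFields.YangMills.Theorems.BalabanUVNodesN15FullPropagatorSizedLive
import Summits.QuantumFields.YangMills.Theorems.BalabanUVNodesN15FullPropagatorSizedNonVanishing
import Summits.QuantumFields.YangMills.Theorems.BalabanUVNodesN15PairedFamilyGuardAx

/-!
# Route «BalabanUVNodes», cluster K4 «SpineRates» — node N15 = NE2, -a lane, part S-8: THE N15 CORNER OF THE K3ᴬ v8 `GuardedReading` AT THE CENTRE-MAP-GENERIC ∕
# RE-CENTRED STAGE-13 READING — the sized genuine family's READING-TYPED faces of parts 84 (S-C `…FullPropagatorSizedLive` §3∕§5) and 86 (`…SizedNonVanishing` §Reading)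
# RE-ISSUED over `RateReading₁₃CoPHCmap N Χ` (T1) ∕ `KeyedLiveCmap Χ` (row R11): pinned ⟹ keyed-live ∧ `N15At`; the positive control with GENUINE objects; the zero-kernel
# reading is OFF the pin — any `Χ`, with the Ax instances the K3ᴬ v8 module `…K3AxV8Defs` reads (`N15PinnedSized`, `KeyedLiveAx (rrOfRecord 𝔯 ksel)`, `n15At_rrOfRecord_of_pinned`)

Cell `pub-ymgap`, seat `pub-ymgap-dag-n15-a` g38 (op 5c K3ᴬ supply lane, depth-2 twin for the stub-1 side; by-name service, D-0071).  `--kind proof --supports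
stmt-QuantumFields-27247 --as helper` (K3ᴬ `SpineGivenEndpointR13SepCoPHVAx`) — COUNT-NEUTRAL; THEOREMS ONLY (0 `def`, 0 `sorry`).  Imports part 84 (S-C: `live_fullGSizedObjects_family`,
`live_and_n15At_fullGSizedObjects_family`), part 86 (`ne_fullGSizedObjects_of_kop_zero_family`) and row R11 `…N15PairedFamilyGuardAx` (`KeyedLiveCmap ∕ KeyedLiveAx` over T1's
`RateReading₁₃CoPHCmap ∕ rateCarriersOfRecord₁₃CoPHCmap`); nothing in the tree is modified or re-declared — every proof is the parent's with the reading type changed (the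
χ-free FAMILY lemmas BY NAME; the centre map `Χ` is never inspected: the N15 objects are constant along the tuple).

WHY.  The registered K3ᴬ v8 skeleton (plan g100, `…K3AxV8Defs` ✓) conjoins in `GuardedReading 𝔯 ksel ℓ` the N15 guard `KeyedLiveAx (rrOfRecord 𝔯 ksel)` (row R11) and the (α-N15)
pin `N15PinnedSized 𝔯` («`(𝔯.lit F θ hP g₀ os).ne2 k = fullGSizedObjects 3 F.hL b a_S ν μ α β c₃₅ p` for some `b, a_S > 0`, …»), over the RE-CENTRED reading type
`RateReading13AxP := RateReading₁₃CoPHAx 2`; its §2 proves the N15 rate conjunct from the pin through the χ-free family lemma.  Parts 84∕86 typed «pinned ⟹ keyed-live ∧ `N15At`»,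
the genuine positive control and «zero kernels ⟹ off the pin» over the CHOICE-centred `RateReading₁₃CoPH`; a `stub_rates13HV` line exhibiting its `∃ 𝔯` witness at the Ax reading
reads the SAME faces at `RateReading₁₃CoPHAx` — supplied here once for every centre map `Χ`, Ax by instantiation.

WHAT IS PROVED.
* §1 (any `Χ`, `𝔯 : RateReading₁₃CoPHCmap N Χ`, the pin body as displayed hypothesis `hpin`): ★★ `keyedLiveCmap_of_pinnedSized` (pinned ⟹ `KeyedLiveCmap Χ` at the bundle of record,
  every selector), ★★ `live_and_n15At_rateCarriersCmap_of_pinnedSized` (pinned ⟹ `Live ∧ N15At` at every bundle, every tuple, admissible or not), ★★★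
  `exists_readingCmap_keyedLive_n15At_fullGSized` (`b, a_S > 0`: SOME centre-map-generic reading is ON the pin, passes `KeyedLiveCmap Χ` for every selector and carries `N15At` at
  every bundle — R3's positive control with GENUINE objects; the `S_N15 (RRec…)` datum-keyed homes of part 84 are NOT re-issued — the key layer has no χ-edition, RR-2 (β)),
  ★★★ `not_sizedPinCmap_of_kop_zero` (a reading with all operator kernels zero at ONE tuple is OFF the pin) + `exists_kop_ne_zero_of_sizedPinCmap`.
* §2 the RE-CENTRED instances (`Χ := fun F => chiβOfRecord₁₃Ax F N`; `𝔯 : RateReading₁₃CoPHAx N`, binder `θ.Provisos₁₃CoPHAx F N`): `keyedLiveAx_of_pinnedSized` (= the v8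
  `GuardedReading`'s second conjunct from its third, BY NAME at `N = 2`), `live_and_n15At_rateCarriersAx_of_pinnedSized`, `exists_readingAx_keyedLive_n15At_fullGSized`,
  `not_sizedPinAx_of_kop_zero`.

HONEST FRAMING.  Kernel composition BY NAME; no estimate in this file.  The family is the `U ≡ 1` (A = 0) content of node N15 for Bałaban's OWN linear objects on the L-divisible tori of
record, size guard live — MODEL LEVEL with respect to the datum's background (NE2⁺ with the background live is NOT PRINTED beyond King's scalar template and NOT proved); a guard
EXCLUDES CARRIER JUNK and the pin NAMES the objects — neither ties them to the run's dressed propagators; **N15 is NOT discharged by this file** (its record, DISCHARGED AS CONSUMED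
p687738, is untouched); K3ᴬ OPEN, no stub closed or claimed; counts UNMOVED (typed 28∕28 · discharged 8∕27 (A 8∕28)); one finite four-torus programme at fixed `ε` — NOT ℝ⁴, NOT
infinite volume, NOT OS, NOT a mass gap, NOT Clay.  Restate-immune (no Theses import).
-/

set_option autoImplicit false

noncomputable section

namespace Summit.QuantumFields.YangMills.BalabanUVNodes.N15.GenuineRecord

open Literature.MathematicalPhysics.QuantumFieldTheory.Balaban1983to89
open Literature.MathematicalPhysics.QuantumFieldTheory.Balaban1983to89.T4Continuum (T4Family ULoop)
open Node00 (Stage13Params Stage13HParams ChiSlot chiβOfRecord₁₃Ax NE2Objects₁₁ RateObjects₁₁ nonempty_rateObjects₁₁)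
open Summit.QuantumFields.YangMills.BalabanUVNodes.N15.AtKeyedHome (neZero_blockFactor)
open Summit.QuantumFields.YangMills.BalabanUVNodes.N15.PairedFamilyGuard (Live KeyedLiveCmap KeyedLiveAx)
open Summit.QuantumFields.YangMills.BalabanUVNodes.N15.SizedNonVanishing (ne_fullGSizedObjects_of_kop_zero_family)
open YMDAG.UVSplit (NE1pCarriers NE2Carriers RateCarriers N15At ne2OfRecord₁₁ RateReading₁₃CoPHCmap RateReading₁₃CoPHAx rateCarriersOfRecord₁₃CoPHCmap)

/-! ## §1 At a centre-map-generic Stage-13 reading `RateReading₁₃CoPHCmap N Χ` (any `Χ`) -/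

section Cmap

variable {N : ℕ} [NeZero N] {Χ : (F : T4Family) → Stage13Params F N → ChiSlot F N}

/-- ★★ **PINNED ⟹ KEYED-LIVE, EVERY SELECTOR** (centre-map-generic): if the reading's N15 objects are part 83's sized genuine objects at every tuple and run length (for some
`b, a_S > 0`, directions, letters — the K3ᴬ v8 `N15PinnedSized` body over the Cmap reading), then `KeyedLiveCmap Χ` holds at the bundle of record for every run-length selector —
the guard reads `Live (ne2OfRecord₁₁ (fullGSizedObjects 3 F.hL …))` = `live_fullGSizedObjects_family`; the keying binders are unused. [bookkeeping] -/
theorem keyedLiveCmap_of_pinnedSized (𝔯 : RateReading₁₃CoPHCmap N Χ)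
    (hpin : ∃ (b aS : ℝ) (ν μ α β : Fin 4) (c35 p : ℝ), 0 < b ∧ 0 < aS ∧
      ∀ (F : T4Family) (θ : Stage13HParams F N) (hP : θ.Provisos₁₃CoPHChi F N (Χ F θ.toStage13Params)) (g₀ : ℕ → ℝ) (os : List (ULoop F)) (k : ℕ),
        (𝔯.lit F θ hP g₀ os).ne2 k = haveI := neZero_blockFactor F; fullGSizedObjects 3 F.hL b aS ν μ α β c35 p)
    (ksel : (F : T4Family) → (θ : Stage13HParams F N) → θ.Provisos₁₃CoPHChi F N (Χ F θ.toStage13Params) → (ℕ → ℝ) → List (ULoop F) → ℕ) :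
    KeyedLiveCmap Χ (fun F θ hP g₀ os => rateCarriersOfRecord₁₃CoPHCmap 𝔯 F θ hP g₀ os (ksel F θ hP g₀ os)) := by
  obtain ⟨b, aS, ν, μ, α, β, c35, p, -, -, h⟩ := hpin
  intro F θ hP _ _ g₀ os
  show Live (ne2OfRecord₁₁ ((𝔯.lit F θ hP g₀ os).ne2 (ksel F θ hP g₀ os)))
  rw [h F θ hP g₀ os (ksel F θ hP g₀ os)]
  exact live_fullGSizedObjects_family F b aS ν μ α β c35 p

/-- ★★ **PINNED ⟹ `Live ∧ N15At` AT EVERY BUNDLE OF RECORD** (centre-map-generic; every Stage-13 parameter with χ-provisos, admissible or not, every `(g₀, os)`, every selector) —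
the K3ᴬ v8 `n15At_rrOfRecord_of_pinned` together with the guard, from the pin alone. [bookkeeping] -/
theorem live_and_n15At_rateCarriersCmap_of_pinnedSized (𝔯 : RateReading₁₃CoPHCmap N Χ)
    (hpin : ∃ (b aS : ℝ) (ν μ α β : Fin 4) (c35 p : ℝ), 0 < b ∧ 0 < aS ∧
      ∀ (F : T4Family) (θ : Stage13HParams F N) (hP : θ.Provisos₁₃CoPHChi F N (Χ F θ.toStage13Params)) (g₀ : ℕ → ℝ) (os : List (ULoop F)) (k : ℕ),
        (𝔯.lit F θ hP g₀ os).ne2 k = haveI := neZero_blockFactor F; fullGSizedObjects 3 F.hL b aS ν μ α β c35 p)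
    (ksel : (F : T4Family) → (θ : Stage13HParams F N) → θ.Provisos₁₃CoPHChi F N (Χ F θ.toStage13Params) → (ℕ → ℝ) → List (ULoop F) → ℕ)
    (F : T4Family) (θ : Stage13HParams F N) (hP : θ.Provisos₁₃CoPHChi F N (Χ F θ.toStage13Params)) (g₀ : ℕ → ℝ) (os : List (ULoop F)) :
    Live (rateCarriersOfRecord₁₃CoPHCmap 𝔯 F θ hP g₀ os (ksel F θ hP g₀ os)).ne2 ∧ N15At (rateCarriersOfRecord₁₃CoPHCmap 𝔯 F θ hP g₀ os (ksel F θ hP g₀ os)).ne2 := by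
  obtain ⟨b, aS, ν, μ, α, β, c35, p, hb, haS, h⟩ := hpin
  show Live (ne2OfRecord₁₁ ((𝔯.lit F θ hP g₀ os).ne2 (ksel F θ hP g₀ os))) ∧ N15At (ne2OfRecord₁₁ ((𝔯.lit F θ hP g₀ os).ne2 (ksel F θ hP g₀ os)))
  rw [h F θ hP g₀ os (ksel F θ hP g₀ os)]
  exact live_and_n15At_fullGSizedObjects_family hb haS ν μ α β c35 p F

/-- ★★★ **SOME CENTRE-MAP-GENERIC STAGE-13 READING IS ON THE (α-N15) PIN, PASSES `KeyedLiveCmap Χ` AT THE BUNDLE OF RECORD FOR EVERY RUN-LENGTH SELECTOR AND CARRIES `N15At`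
THERE — ITS NE2 OBJECTS BAŁABAN's GENUINE `U ≡ 1` OBJECTS, SIZE GUARD LIVE** (`b, a_S > 0`, every `ν μ α β c₃₅ p`, any `Χ`): the reading whose NE2 objects at every tuple and run
length are `fullGSizedObjects 3 F.hL b a_S ν μ α β c₃₅ p` (the other rate objects = RR-1's sanity inhabitant, the dressed tower empty — «don't-care» fillers of NO content, displayed
in the proof).  R3 reading: the K3ᴬ v8 conjunction «`KeyedLiveAx (rrOfRecord 𝔯 ksel) ∧ N15PinnedSized 𝔯`» is satisfiable at the N15 slot by the GENUINE family (MODEL level w.r.t.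
the background). [bookkeeping] -/
theorem exists_readingCmap_keyedLive_n15At_fullGSized {b aS : ℝ} (hb : 0 < b) (haS : 0 < aS) (ν μ α β : Fin 4) (c35 p : ℝ) :
    ∃ 𝔯 : RateReading₁₃CoPHCmap N Χ,
      (∀ (F : T4Family) (θ : Stage13HParams F N) (hP : θ.Provisos₁₃CoPHChi F N (Χ F θ.toStage13Params)) (g₀ : ℕ → ℝ) (os : List (ULoop F)) (k : ℕ),
        (𝔯.lit F θ hP g₀ os).ne2 k = haveI := neZero_blockFactor F; fullGSizedObjects 3 F.hL b aS ν μ α β c35 p) ∧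
      ∀ ksel : (F : T4Family) → (θ : Stage13HParams F N) → θ.Provisos₁₃CoPHChi F N (Χ F θ.toStage13Params) → (ℕ → ℝ) → List (ULoop F) → ℕ,
        KeyedLiveCmap Χ (fun F θ hP g₀ os => rateCarriersOfRecord₁₃CoPHCmap 𝔯 F θ hP g₀ os (ksel F θ hP g₀ os)) ∧
        ∀ (F : T4Family) (θ : Stage13HParams F N) (hP : θ.Provisos₁₃CoPHChi F N (Χ F θ.toStage13Params)) (g₀ : ℕ → ℝ) (os : List (ULoop F)),
          N15At (rateCarriersOfRecord₁₃CoPHCmap 𝔯 F θ hP g₀ os (ksel F θ hP g₀ os)).ne2 := by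
  obtain ⟨r₀⟩ := nonempty_rateObjects₁₁ (N := N)
  let lit : (F : T4Family) → (θ : Stage13HParams F N) → θ.Provisos₁₃CoPHChi F N (Χ F θ.toStage13Params) → (ℕ → ℝ) → List (ULoop F) → RateObjects₁₁ N :=
    fun F _ _ _ _ => ⟨r₀.u3, r₀.ne3, fun _ => haveI := neZero_blockFactor F; fullGSizedObjects 3 F.hL b aS ν μ α β c35 p⟩
  let 𝔯 : RateReading₁₃CoPHCmap N Χ := ⟨lit, fun _ _ _ _ _ => (⟨Empty, ⟨fun q => q.elim, fun q => q.elim, fun q => q.elim⟩, 0⟩ : NE1pCarriers)⟩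
  have h𝔯 : ∀ (F : T4Family) (θ : Stage13HParams F N) (hP : θ.Provisos₁₃CoPHChi F N (Χ F θ.toStage13Params)) (g₀ : ℕ → ℝ) (os : List (ULoop F)) (k : ℕ),
      (𝔯.lit F θ hP g₀ os).ne2 k = haveI := neZero_blockFactor F; fullGSizedObjects 3 F.hL b aS ν μ α β c35 p := fun _ _ _ _ _ _ => rfl
  have key : ∀ F : T4Family, Live (ne2OfRecord₁₁ (haveI := neZero_blockFactor F; fullGSizedObjects 3 F.hL b aS ν μ α β c35 p)) ∧
      N15At (ne2OfRecord₁₁ (haveI := neZero_blockFactor F; fullGSizedObjects 3 F.hL b aS ν μ α β c35 p)) :=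
    fun F => live_and_n15At_fullGSizedObjects_family hb haS ν μ α β c35 p F
  exact ⟨𝔯, h𝔯, fun ksel => ⟨fun F θ hP _ _ g₀ os => (key F).1, fun F θ hP g₀ os => (key F).2⟩⟩

/-- ★★★ **R3 AT THE CENTRE-MAP-GENERIC READING — THE ZERO-KERNEL READING IS OFF THE PIN**: for ANY reading `𝔯 : RateReading₁₃CoPHCmap N Χ` and ANY tuple `(F, θ, hP, g₀, os, k)` at
which ALL operator kernels of `(𝔯.lit F θ hP g₀ os).ne2 k` vanish, the pin body is FALSE (part 86's family lemma `ne_fullGSizedObjects_of_kop_zero_family` BY NAME). [bookkeeping] -/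
theorem not_sizedPinCmap_of_kop_zero (𝔯 : RateReading₁₃CoPHCmap N Χ) {F : T4Family} {θ : Stage13HParams F N} {hP : θ.Provisos₁₃CoPHChi F N (Χ F θ.toStage13Params)}
    {g₀ : ℕ → ℝ} {os : List (ULoop F)} {k : ℕ} (hz : ∀ i n U lam y, ((((𝔯.lit F θ hP g₀ os).ne2 k).Kop i).e n U lam y) = 0) :
    ¬ ∃ (b aS : ℝ) (ν μ α β : Fin 4) (c35 p : ℝ), 0 < b ∧ 0 < aS ∧
        ∀ (F : T4Family) (θ : Stage13HParams F N) (hP : θ.Provisos₁₃CoPHChi F N (Χ F θ.toStage13Params)) (g₀ : ℕ → ℝ) (os : List (ULoop F)) (k : ℕ),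
          (𝔯.lit F θ hP g₀ os).ne2 k = haveI := neZero_blockFactor F; fullGSizedObjects 3 F.hL b aS ν μ α β c35 p := by
  rintro ⟨b, aS, ν, μ, α, β, c35, p, hb, -, hpin⟩
  exact ne_fullGSizedObjects_of_kop_zero_family F hb aS ν μ α β c35 p _ hz (hpin F θ hP g₀ os k)

/-- … EQUIVALENTLY: a centre-map-generic reading ON the pin has, at EVERY tuple and run length, an operator kernel entry that does not vanish. [bookkeeping] -/
theorem exists_kop_ne_zero_of_sizedPinCmap (𝔯 : RateReading₁₃CoPHCmap N Χ)
    (hpin : ∃ (b aS : ℝ) (ν μ α β : Fin 4) (c35 p : ℝ), 0 < b ∧ 0 < aS ∧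
      ∀ (F : T4Family) (θ : Stage13HParams F N) (hP : θ.Provisos₁₃CoPHChi F N (Χ F θ.toStage13Params)) (g₀ : ℕ → ℝ) (os : List (ULoop F)) (k : ℕ),
        (𝔯.lit F θ hP g₀ os).ne2 k = haveI := neZero_blockFactor F; fullGSizedObjects 3 F.hL b aS ν μ α β c35 p)
    (F : T4Family) (θ : Stage13HParams F N) (hP : θ.Provisos₁₃CoPHChi F N (Χ F θ.toStage13Params)) (g₀ : ℕ → ℝ) (os : List (ULoop F)) (k : ℕ) :
    ∃ i n U lam y, ((((𝔯.lit F θ hP g₀ os).ne2 k).Kop i).e n U lam y) ≠ 0 := by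
  by_contra h
  push Not at h
  exact not_sizedPinCmap_of_kop_zero 𝔯 h hpin

end Cmap

/-! ## §2 At the RE-CENTRED reading `RateReading₁₃CoPHAx N` (the K3ᴬ v8 `RateReading13AxP` at `N = 2`; binder `θ.Provisos₁₃CoPHAx F N`) -/

section Ax

variable {N : ℕ} [NeZero N]

/-- ★★ **THE K3ᴬ v8 `GuardedReading`'s N15 GUARD FROM ITS N15 PIN, BY NAME**: `N15PinnedSized 𝔯 → KeyedLiveAx (rrOfRecord 𝔯 ksel)` for every selector (§1 at the Ax centre map;
`rrOfRecord 𝔯 ksel F θ hP g₀ os` IS `rateCarriersOfRecord₁₃CoPHCmap 𝔯 F θ hP g₀ os (ksel F θ hP g₀ os)`). [bookkeeping] -/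
theorem keyedLiveAx_of_pinnedSized (𝔯 : RateReading₁₃CoPHAx N)
    (hpin : ∃ (b aS : ℝ) (ν μ α β : Fin 4) (c35 p : ℝ), 0 < b ∧ 0 < aS ∧
      ∀ (F : T4Family) (θ : Stage13HParams F N) (hP : θ.Provisos₁₃CoPHAx F N) (g₀ : ℕ → ℝ) (os : List (ULoop F)) (k : ℕ),
        (𝔯.lit F θ hP g₀ os).ne2 k = haveI := neZero_blockFactor F; fullGSizedObjects 3 F.hL b aS ν μ α β c35 p)
    (ksel : (F : T4Family) → (θ : Stage13HParams F N) → θ.Provisos₁₃CoPHAx F N → (ℕ → ℝ) → List (ULoop F) → ℕ) :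
    KeyedLiveAx (fun F θ hP g₀ os => rateCarriersOfRecord₁₃CoPHCmap 𝔯 F θ hP g₀ os (ksel F θ hP g₀ os)) :=
  keyedLiveCmap_of_pinnedSized 𝔯 hpin ksel

/-- ★★ `Live ∧ N15At` at every bundle of a pinned RE-CENTRED reading (§1 at the Ax centre map). [bookkeeping] -/
theorem live_and_n15At_rateCarriersAx_of_pinnedSized (𝔯 : RateReading₁₃CoPHAx N)
    (hpin : ∃ (b aS : ℝ) (ν μ α β : Fin 4) (c35 p : ℝ), 0 < b ∧ 0 < aS ∧
      ∀ (F : T4Family) (θ : Stage13HParams F N) (hP : θ.Provisos₁₃CoPHAx F N) (g₀ : ℕ → ℝ) (os : List (ULoop F)) (k : ℕ),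
        (𝔯.lit F θ hP g₀ os).ne2 k = haveI := neZero_blockFactor F; fullGSizedObjects 3 F.hL b aS ν μ α β c35 p)
    (ksel : (F : T4Family) → (θ : Stage13HParams F N) → θ.Provisos₁₃CoPHAx F N → (ℕ → ℝ) → List (ULoop F) → ℕ)
    (F : T4Family) (θ : Stage13HParams F N) (hP : θ.Provisos₁₃CoPHAx F N) (g₀ : ℕ → ℝ) (os : List (ULoop F)) :
    Live (rateCarriersOfRecord₁₃CoPHCmap 𝔯 F θ hP g₀ os (ksel F θ hP g₀ os)).ne2 ∧ N15At (rateCarriersOfRecord₁₃CoPHCmap 𝔯 F θ hP g₀ os (ksel F θ hP g₀ os)).ne2 :=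
  live_and_n15At_rateCarriersCmap_of_pinnedSized 𝔯 hpin ksel F θ hP g₀ os

/-- ★★★ The genuine positive control at the RE-CENTRED reading: some `RateReading₁₃CoPHAx N` is on the pin, passes `KeyedLiveAx` for every selector and carries `N15At` at every
bundle (§1 at the Ax centre map). [bookkeeping] -/
theorem exists_readingAx_keyedLive_n15At_fullGSized {b aS : ℝ} (hb : 0 < b) (haS : 0 < aS) (ν μ α β : Fin 4) (c35 p : ℝ) :
    ∃ 𝔯 : RateReading₁₃CoPHAx N,
      (∀ (F : T4Family) (θ : Stage13HParams F N) (hP : θ.Provisos₁₃CoPHAx F N) (g₀ : ℕ → ℝ) (os : List (ULoop F)) (k : ℕ),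
        (𝔯.lit F θ hP g₀ os).ne2 k = haveI := neZero_blockFactor F; fullGSizedObjects 3 F.hL b aS ν μ α β c35 p) ∧
      ∀ ksel : (F : T4Family) → (θ : Stage13HParams F N) → θ.Provisos₁₃CoPHAx F N → (ℕ → ℝ) → List (ULoop F) → ℕ,
        KeyedLiveAx (fun F θ hP g₀ os => rateCarriersOfRecord₁₃CoPHCmap 𝔯 F θ hP g₀ os (ksel F θ hP g₀ os)) ∧
        ∀ (F : T4Family) (θ : Stage13HParams F N) (hP : θ.Provisos₁₃CoPHAx F N) (g₀ : ℕ → ℝ) (os : List (ULoop F)),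
          N15At (rateCarriersOfRecord₁₃CoPHCmap 𝔯 F θ hP g₀ os (ksel F θ hP g₀ os)).ne2 :=
  exists_readingCmap_keyedLive_n15At_fullGSized (Χ := fun F => chiβOfRecord₁₃Ax F N) hb haS ν μ α β c35 p

/-- ★★★ R3 at the RE-CENTRED reading: a reading with all operator kernels zero at ONE tuple is OFF the K3ᴬ v8 pin `N15PinnedSized` (§1 at the Ax centre map). [bookkeeping] -/
theorem not_sizedPinAx_of_kop_zero (𝔯 : RateReading₁₃CoPHAx N) {F : T4Family} {θ : Stage13HParams F N} {hP : θ.Provisos₁₃CoPHAx F N} {g₀ : ℕ → ℝ}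
    {os : List (ULoop F)} {k : ℕ} (hz : ∀ i n U lam y, ((((𝔯.lit F θ hP g₀ os).ne2 k).Kop i).e n U lam y) = 0) :
    ¬ ∃ (b aS : ℝ) (ν μ α β : Fin 4) (c35 p : ℝ), 0 < b ∧ 0 < aS ∧
        ∀ (F : T4Family) (θ : Stage13HParams F N) (hP : θ.Provisos₁₃CoPHAx F N) (g₀ : ℕ → ℝ) (os : List (ULoop F)) (k : ℕ),
          (𝔯.lit F θ hP g₀ os).ne2 k = haveI := neZero_blockFactor F; fullGSizedObjects 3 F.hL b aS ν μ α β c35 p :=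
  not_sizedPinCmap_of_kop_zero 𝔯 hz

end Ax

end Summit.QuantumFields.YangMills.BalabanUVNodes.N15.GenuineRecord

end
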